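import Mathlib
import HarnessLib
import Summits.HubbardSuperconductivity.HubbardSuperconductivity.Theorems.KLProgrammeKLRegimeTwoVolumeLipDoubledTruncBornDiffHstep
import Summits.HubbardSuperconductivity.HubbardSuperconductivity.Theorems.KLProgrammeKLRegimeTwoVolumeLipDoubledTruncProfiles
import Summits.HubbardSuperconductivity.HubbardSuperconductivity.Theorems.KLProgrammeKLRegimeTwoVolumeLipStepLinkUniform

/-!
# Route `KLProgramme` — crux K3 ENGINE (stmt-HubbardSuperconductivity-20437 `KLRegimeEngineV17F2`), stub (e) proof-input «(e)-D-ROWS», keying (A′), REKEY-D file D5T-c: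
# THE k-UNIFORM LINK OF THE SOURCE-TRUNCATED DOUBLED (plain-track) TWO-VOLUME LIPSCHITZ TOWER — the truncated born difference of block `k` in track-`0` floor units bounded by
# the LITERAL Lipschitz step of `EngineV8.towerBornDiff_le_law_of_profile_tok` at k-FREE parameters
# (seat hubbard-kl-k3c4-p1 g28; truncated-doubled twin of ✓ `…TwoVolumeLipStepLinkUniform.klLipBornDiffSup_le_kitStep_of_bounds` (the sector LINK, g25), built on
#  D5T-b `klLipBornDiffSupDT_le_hstep_rate` and D5T-p `glueD_wt_profile_le_measDT` / `inputDiffDT_wt_profile_le_measDT`; `--supports` 23356)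

Same chain, same units and same k-INDEPENDENT parameters as the sector LINK (`σ̄ = κ̄²ε²/cW²`, `τ̄ = 4e⁴κ̄²ε²/cW²`, `ψ̄ = cW²/(κ̄²ε²)`, `Φ̄ = eᾱ/κ̄²`, `Ct = 6`, arrays
`W̄ = 32`, `Z̄ = cW²/8`); the one-volume arrays are now the MEASURED SIZES of the truncated doubled inputs `μV, μF := klLipInputMeasDT L, (bL) … j_w (2m)/klLevUnitF β M 0 m (dk−1)`
(all `s < 3` plain legs together: sector part + token #24's one- and two-leg parts), the difference array `dE m := klLipInputDiffSupDT … (2m) R_in/(ε·klLevUnitF β M 0 m (dk−1))`,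
the output `klLipBornDiffSupDT … d k (n+1) (D₀+r)/(ε·klLevUnitF β M 0 p (dk))` (ungraded deep sup over pins of either copy).

* **`klLipBornDiffSupDT_le_kitStep_of_bounds`** — the displayed row.

Compositions of landed theorems and real algebra (proof = the sector LINK's); nothing asserts the (D) rows, stub (e), VL, K3 or superconductivity.
References: BGM 2006 §2.8 (2.76)–(2.84), (2.93)–(2.98), §2.9 (4.3)–(4.6), §3 (3.2)–(3.8) [cite: BenfattoGiulianiMastropietro2006].
-/

noncomputable section

namespace Summit.HubbardSuperconductivity.HubbardSuperconductivity.Theorems.TwoVolumeLip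

set_option linter.dupNamespace false -- summit = problem name (single-conjunct summit), D-0017

open Finset Literature.MathematicalPhysics.QuantumLattice GrassmannAlgebra Literature.Probability.LatticeModels
  Literature.Probability.LatticeModels.BattleFederbush
open Literature.MathematicalPhysics.QuantumLattice.FermiRG
open Summit.HubbardSuperconductivity.HubbardSuperconductivity.Theorems.KLRegimeSplit
open Summit.HubbardSuperconductivity.HubbardSuperconductivity.Theorems.KLProgrammeLegKernels
open Summit.HubbardSuperconductivity.HubbardSuperconductivity.Theorems.DispersionFlow
open Summit.HubbardSuperconductivity.HubbardSuperconductivity.Theorems.EngineV8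
open Summit.HubbardSuperconductivity.HubbardSuperconductivity.Theorems.TwoVolumeSource
open Summit.HubbardSuperconductivity.HubbardSuperconductivity.Theorems.TwoVolumeDefect

variable {L b M : ℕ} [NeZero L] [NeZero (b * L)] [NeZero M]

set_option maxHeartbeats 1600000 in -- large statement, three units identities, one big door application
/-- **THE TRUNCATED-DOUBLED TWO-VOLUME BLOCK STEP (`k ≥ 1`) AT k-FREE BOUNDS OF THE BLOCK DATA** — truncated-doubled twin of ✓ `klLipBornDiffSup_le_kitStep_of_bounds` (labels `SrcLabel`, sups `klLipBornDiffSupDT`/`klLipInputDiffSupDT`, measured sizes `klLipInputMeasDT` at both volumes, output pins of either copy, `cW ≥ 1`); two-volume twin of `klTowerBornWtAt_succ_le_kitStep_of_bounds`.  Block `k ≥ 1`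
(`1 ≤ d`), common frame `K`, glued-weight rate `j_w`; envelopes `κ²·8^{dk} ≤ κ̄²` (Gram), `α ≤ ᾱ·4^{dk}` (glued-weight rows of the FINE block covariance); transfer rows
`cW > 0` of `klLipTransfer (bL)` at rate `j_r` (`0 ≤ Λ_T ≤ Λ_{j_r}`); zone constant `1 ≤ Λ ≤ 1 + Λ_{j_w}(R′+1)`; depths `2r ≤ D₀`, `R_in + R′ ≤ D₀`; degree `n + 1 = 2p`;
SRC data of degree `n+1` verbatim from `klLipBornDiffSupDT_le_hstep_rate`.  ARRAYS (track-`0` floor units of the measuring family `dk−1`; the two-volume sups carry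
the extra `ε⁻¹` that E1's `ε^{2m−1}`-normalised arrays have): `dE m := klLipInputDiffSup … (2m) R_in/(ε·klLevUnitF β M 0 m (dk−1))`,
`μF, μV := klLipInputMeasDT (bL), L … j_w (2m)/klLevUnitF β M 0 m (dk−1)`; difference array `dμ m := 32·(cW²/8)^m·(dE m + (Λ⁻¹+t)(μF m + μV m))`, majorant
`μb m := 32·(cW²/8)^m·(μV m + (μF m + μV m) + dE m)`, `t = 1/(1+Λ_T(r+1))`.  CONCLUSION: under the guard `Φ̄·towerV D τ̄ μb < 1`,
`klLipBornDiffSup … d k (n+1) (D₀+r)/(ε·klLevUnitF β M 0 p (dk)) ≤ towerFO D σ̄ dμ p + Σ_{n′∈[2,N]} e Φ̄^{n′−1} ψ̄^p towerSLip D τ̄ dμ μb n′ p + 6·(ψ̄^p e V̄ (Φ̄V̄)^N/(1−Φ̄V̄))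
+ SRC/(ε·klLevUnitF β M 0 p (dk))` with the k-INDEPENDENT `σ̄ = κ̄²ε²/cW²`, `τ̄ = 4e⁴κ̄²ε²/cW²`, `ψ̄ = cW²/(κ̄²ε²)`, `Φ̄ = eᾱ/κ̄²` (= E1's W2 parameters at `c̄r = c̄c = cW/ε`,
`W̄ = 32`, `Z̄ = cW²/8`; `4^{dk}·8^{dk}·2^{−5dk} = 1`).  [cite: BenfattoGiulianiMastropietro2006, §2.8 (2.76)-(2.84), §3 (3.2)-(3.8)] -/
theorem klLipBornDiffSupDT_le_kitStep_of_bounds {β : ℝ} (hβ : 0 < β) (U μ : ℝ) (K : TrigPolyC4v) {d k : ℕ} (jw : ℕ) (hd : 1 ≤ d) (hk : 1 ≤ k)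
    (hZf : hubbardEffPartitionFnCT (b * L) M β U μ 0 K (klScale klE0 (d * k)) ≠ 0)
    (hZc : hubbardEffPartitionFnCT L M β U μ 0 K (klScale klE0 (d * k)) ≠ 0)
    {κ κb : ℝ} (hκ : 0 < κ) (hκb : 0 < κb) (hκκb : κ ^ 2 * (8 : ℝ) ^ (d * k) ≤ κb ^ 2)
    (hGB : IsGramBoundedR ((sectorSubMatrix (b * L) M β (bgmFatMultiplier (b * L) M klE0 β (nambuXiCT (b * L) μ K) (d * k - 1))).transpose * hubbardCovSliceCT (b * L) M β μ 0 K (klScale klE0 (d * (k + 1))) (klScale klE0 (d * k)) * sectorSubMatrix (b * L) M β (bgmFatMultiplier (b * L) M klE0 β (nambuXiCT (b * L) μ K) (d * k - 1))) κ)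
    {α αb : ℝ} (hαb : 0 < αb) (hααb : α ≤ αb * (4 : ℝ) ^ (d * k))
    (hrow : ∀ X, ∑ Y, ‖((sectorSubMatrix (b * L) M β (bgmFatMultiplier (b * L) M klE0 β (nambuXiCT (b * L) μ K) (d * k - 1))).transpose * hubbardCovSliceCT (b * L) M β μ 0 K (klScale klE0 (d * (k + 1))) (klScale klE0 (d * k)) * sectorSubMatrix (b * L) M β (bgmFatMultiplier (b * L) M klE0 β (nambuXiCT (b * L) μ K) (d * k - 1))) X Y‖ * klGluedWt L b M β jw (sectorCount (d * k - 1)) {X, Y} ≤ α)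
    (hcol : ∀ Y, ∑ X, ‖((sectorSubMatrix (b * L) M β (bgmFatMultiplier (b * L) M klE0 β (nambuXiCT (b * L) μ K) (d * k - 1))).transpose * hubbardCovSliceCT (b * L) M β μ 0 K (klScale klE0 (d * (k + 1))) (klScale klE0 (d * k)) * sectorSubMatrix (b * L) M β (bgmFatMultiplier (b * L) M klE0 β (nambuXiCT (b * L) μ K) (d * k - 1))) X Y‖ * klGluedWt L b M β jw (sectorCount (d * k - 1)) {X, Y} ≤ α)
    {D : ℕ} (hD : Fintype.card (SrcLabel (b * L) M (d * k - 1)) / 2 ≤ D)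
    (Rin R' : ℕ) {Λ : ℝ} (hΛ1 : 1 ≤ Λ) (hΛle : Λ ≤ 1 + klScale klE0 jw * ((R' : ℝ) + 1))
    (jr : ℕ) {ΛT cW : ℝ} (hΛT : 0 ≤ ΛT) (hΛr : ΛT ≤ klScale klE0 jr) (hcW1 : 1 ≤ cW)
    (hrowT : ∀ x, ∑ y', ‖klLipTransfer (b * L) M β μ K d k x y'‖ *
      klScaleWt (b * L) M β jr {latticeLegPos (2 * (2 * M)) x, latticeLegPos (2 * (2 * M)) y'} ≤ cW)
    (hcolT : ∀ y', ∑ x, ‖klLipTransfer (b * L) M β μ K d k x y'‖ *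
      klScaleWt (b * L) M β jr {latticeLegPos (2 * (2 * M)) x, latticeLegPos (2 * (2 * M)) y'} ≤ cW)
    (D₀ r : ℕ) (hD₀ : 2 * r ≤ D₀) (hRR' : Rin + R' ≤ D₀)
    {n p : ℕ} (hq : 2 * p = n + 1)
    {N Nfar Es NDs : ℝ} (hN0 : 0 ≤ N) (hNfar0 : 0 ≤ Nfar) (hEs0 : 0 ≤ Es) (hNDs0 : 0 ≤ NDs)
    (hN : ∀ (q : Fin (n + 1)) y, ∑ Y ∈ univ.filter (fun Y : Fin (n + 1) → SrcLabel L M (d * k - 1) => Y q = y),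
      ‖kernel ℂ (effAction ℂ (klLipCovD L M β μ K d k) (klLipInputDT L M β U μ K d k) - klLipInputDT L M β U μ K d k) (n + 1) Y‖ ≤ N)
    (hNfar : ∀ (q : Fin (n + 1)) y (i : Fin (n + 1)),
      ∑ Y ∈ univ.filter (fun Y : Fin (n + 1) → SrcLabel L M (d * k - 1) => Y q = y ∧ r < Torus.tnorm ((Y q).1.1.2 - (Y i).1.1.2)),
        ‖kernel ℂ (effAction ℂ (klLipCovD L M β μ K d k) (klLipInputDT L M β U μ K d k) - klLipInputDT L M β U μ K d k) (n + 1) Y‖ ≤ Nfar)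
    (hEs : ∀ (q : Fin (n + 1)) (y' : SrcLabel (b * L) M (d * k - 1)), y' ∈ klDeepPinsD (V := b * L) (M := M) (n := d * k - 1) L D₀ →
      ∑ Y' ∈ univ.filter (fun Y' : Fin (n + 1) → SrcLabel (b * L) M (d * k - 1) => Y' q = y'),
        ‖kernel ℂ ((effAction ℂ (klLipCovD (b * L) M β μ K d k) (klGlueD L b M (d * k - 1) (klLipInputDT L M β U μ K d k)) -
              klGlueD L b M (d * k - 1) (klLipInputDT L M β U μ K d k)) -
            klGlueD L b M (d * k - 1)
              (effAction ℂ (klLipCovD L M β μ K d k) (klLipInputDT L M β U μ K d k) - klLipInputDT L M β U μ K d k)) (n + 1) Y'‖ ≤ Es)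
    (hNDs : ∀ (q : Fin (n + 1)) (y' : SrcLabel (b * L) M (d * k - 1)),
      ∑ Y' ∈ univ.filter (fun Y' : Fin (n + 1) → SrcLabel (b * L) M (d * k - 1) => Y' q = y'),
        ‖kernel ℂ ((effAction ℂ (klLipCovD (b * L) M β μ K d k) (klGlueD L b M (d * k - 1) (klLipInputDT L M β U μ K d k)) -
              klGlueD L b M (d * k - 1) (klLipInputDT L M β U μ K d k)) -
            klGlueD L b M (d * k - 1)
              (effAction ℂ (klLipCovD L M β μ K d k) (klLipInputDT L M β U μ K d k) - klLipInputDT L M β U μ K d k)) (n + 1) Y'‖ ≤ NDs)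
    {Nt : ℕ} (hNt : 1 ≤ Nt)
    (hguard : (Real.exp 1 * αb / κb ^ 2) * towerV D (4 * Real.exp 4 * κb ^ 2 * imagTimeWeight β M ^ 2 / cW ^ 2) (fun m => 32 * ((cW ^ 2 / 8) ^ m * (klLipInputMeasDT L M β U μ K d k jw (2 * m) / klLevUnitF β M 0 m (d * k - 1) + (klLipInputMeasDT (b * L) M β U μ K d k jw (2 * m) / klLevUnitF β M 0 m (d * k - 1) + klLipInputMeasDT L M β U μ K d k jw (2 * m) / klLevUnitF β M 0 m (d * k - 1)) + klLipInputDiffSupDT L b M β U μ K d k (2 * m) Rin / (imagTimeWeight β M * klLevUnitF β M 0 m (d * k - 1))))) < 1) :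
    klLipBornDiffSupDT L b M β U μ K d k (n + 1) (D₀ + r) / (imagTimeWeight β M * klLevUnitF β M 0 p (d * k)) ≤
      towerFO D (κb ^ 2 * imagTimeWeight β M ^ 2 / cW ^ 2) (fun m => 32 * ((cW ^ 2 / 8) ^ m * (klLipInputDiffSupDT L b M β U μ K d k (2 * m) Rin / (imagTimeWeight β M * klLevUnitF β M 0 m (d * k - 1)) + (Λ⁻¹ + 1 / (1 + ΛT * ((r : ℝ) + 1))) * (klLipInputMeasDT (b * L) M β U μ K d k jw (2 * m) / klLevUnitF β M 0 m (d * k - 1) + klLipInputMeasDT L M β U μ K d k jw (2 * m) / klLevUnitF β M 0 m (d * k - 1))))) p +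
        ∑ n' ∈ Icc 2 Nt, Real.exp 1 * (Real.exp 1 * αb / κb ^ 2) ^ (n' - 1) * (cW ^ 2 / (κb ^ 2 * imagTimeWeight β M ^ 2)) ^ p * towerSLip D (4 * Real.exp 4 * κb ^ 2 * imagTimeWeight β M ^ 2 / cW ^ 2) (fun m => 32 * ((cW ^ 2 / 8) ^ m * (klLipInputDiffSupDT L b M β U μ K d k (2 * m) Rin / (imagTimeWeight β M * klLevUnitF β M 0 m (d * k - 1)) + (Λ⁻¹ + 1 / (1 + ΛT * ((r : ℝ) + 1))) * (klLipInputMeasDT (b * L) M β U μ K d k jw (2 * m) / klLevUnitF β M 0 m (d * k - 1) + klLipInputMeasDT L M β U μ K d k jw (2 * m) / klLevUnitF β M 0 m (d * k - 1))))) (fun m => 32 * ((cW ^ 2 / 8) ^ m * (klLipInputMeasDT L M β U μ K d k jw (2 * m) / klLevUnitF β M 0 m (d * k - 1) + (klLipInputMeasDT (b * L) M β U μ K d k jw (2 * m) / klLevUnitF β M 0 m (d * k - 1) + klLipInputMeasDT L M β U μ K d k jw (2 * m) / klLevUnitF β M 0 m (d * k - 1)) + klLipInputDiffSupDT L b M β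 U μ K d k (2 * m) Rin / (imagTimeWeight β M * klLevUnitF β M 0 m (d * k - 1))))) n' p +
        6 * ((cW ^ 2 / (κb ^ 2 * imagTimeWeight β M ^ 2)) ^ p * Real.exp 1 * towerV D (4 * Real.exp 4 * κb ^ 2 * imagTimeWeight β M ^ 2 / cW ^ 2) (fun m => 32 * ((cW ^ 2 / 8) ^ m * (klLipInputMeasDT L M β U μ K d k jw (2 * m) / klLevUnitF β M 0 m (d * k - 1) + (klLipInputMeasDT (b * L) M β U μ K d k jw (2 * m) / klLevUnitF β M 0 m (d * k - 1) + klLipInputMeasDT L M β U μ K d k jw (2 * m) / klLevUnitF β M 0 m (d * k - 1)) + klLipInputDiffSupDT L b M β U μ K d k (2 * m) Rin / (imagTimeWeight β M * klLevUnitF β M 0 m (d * k - 1))))) * ((Real.exp 1 * αb / κb ^ 2) * towerV D (4 * Real.exp 4 * κb ^ 2 * imagTimeWeight β M ^ 2 / cW ^ 2) (fun m => 32 * ((cW ^ 2 / 8) ^ m * (klLipInputMeasDT L M β U μ K d k jw (2 * m) / klLevUnitF β M 0 m (d * k - 1) + (klLipInputMeasDT (b * L) M β U μ K d k jw (2 *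 m) / klLevUnitF β M 0 m (d * k - 1) + klLipInputMeasDT L M β U μ K d k jw (2 * m) / klLevUnitF β M 0 m (d * k - 1)) + klLipInputDiffSupDT L b M β U μ K d k (2 * m) Rin / (imagTimeWeight β M * klLevUnitF β M 0 m (d * k - 1)))))) ^ Nt / (1 - (Real.exp 1 * αb / κb ^ 2) * towerV D (4 * Real.exp 4 * κb ^ 2 * imagTimeWeight β M ^ 2 / cW ^ 2) (fun m => 32 * ((cW ^ 2 / 8) ^ m * (klLipInputMeasDT L M β U μ K d k jw (2 * m) / klLevUnitF β M 0 m (d * k - 1) + (klLipInputMeasDT (b * L) M β U μ K d k jw (2 * m) / klLevUnitF β M 0 m (d * k - 1) + klLipInputMeasDT L M β U μ K d k jw (2 * m) / klLevUnitF β M 0 m (d * k - 1)) + klLipInputDiffSupDT L b M β U μ K d k (2 * m) Rin / (imagTimeWeight β M * klLevUnitF β M 0 m (d * k - 1))))))) +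
      (cW ^ n * (cW * Es + cW / (1 + ΛT * ((r : ℝ) + 1)) * NDs) + (2 * cW ^ n * (cW / (1 + ΛT * ((r : ℝ) + 1))) * N + n * cW ^ n * (5 * (cW / (1 + ΛT * ((r : ℝ) + 1))) * N + 2 * cW * Nfar))) / (imagTimeWeight β M * klLevUnitF β M 0 p (d * k)) := by
  have hcW : 0 < cW := one_pos.trans_le hcW1
  have hx : 0 < imagTimeWeight β M := imagTimeWeight_pos_of_pos (M := M) hβ
  have hJ₁ : 1 ≤ d * k := le_trans hk (Nat.le_mul_of_pos_left k (by omega))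
  have hp1 : 1 ≤ p := by omega
  have h8 : (0 : ℝ) < (8 : ℝ) ^ (d * k) := by positivity
  have he4' : Real.exp 4 = Real.exp 2 ^ 2 := by rw [← Real.exp_nat_mul]; norm_num
  -- the Gram constant at the bound: `κ′ ≥ κ`, `κ′²·8^{dk} = κ̄²`
  obtain ⟨κ', hκ'0, hκκ', hκ'sq⟩ := exists_sqrt_scaled hκ hκb h8 hκκb
  have hGB' := TorusFourierL2.isGramBoundedR_of_le hGB hκ.le hκκ'
  -- the decay constant at the bound
  have hα'0 : 0 < αb * (4 : ℝ) ^ (d * k) := by positivity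
  have hrow2 : ∀ X, ∑ Y, ‖((sectorSubMatrix (b * L) M β (bgmFatMultiplier (b * L) M klE0 β (nambuXiCT (b * L) μ K) (d * k - 1))).transpose * hubbardCovSliceCT (b * L) M β μ 0 K (klScale klE0 (d * (k + 1))) (klScale klE0 (d * k)) * sectorSubMatrix (b * L) M β (bgmFatMultiplier (b * L) M klE0 β (nambuXiCT (b * L) μ K) (d * k - 1))) X Y‖ * klGluedWt L b M β jw (sectorCount (d * k - 1)) {X, Y} ≤ αb * (4 : ℝ) ^ (d * k) :=
    fun X => (hrow X).trans hααb
  have hcol2 : ∀ Y, ∑ X, ‖((sectorSubMatrix (b * L) M β (bgmFatMultiplier (b * L) M klE0 β (nambuXiCT (b * L) μ K) (d * k - 1))).transpose * hubbardCovSliceCT (b * L) M β μ 0 K (klScale klE0 (d * (k + 1))) (klScale klE0 (d * k)) * sectorSubMatrix (b * L) M β (bgmFatMultiplier (b * L) M klE0 β (nambuXiCT (b * L) μ K) (d * k - 1))) X Y‖ * klGluedWt L b M β jw (sectorCount (d * k - 1)) {X, Y} ≤ αb * (4 : ℝ) ^ (d * k) :=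
    fun Y => (hcol Y).trans hααb
  -- abbreviations: the measuring family's units (ε-free `K_c`), the three arrays, the parameters
  set ε : ℝ := imagTimeWeight β M with hε
  set Kc : ℝ := ((2 : ℝ) ^ (5 * (d * k - 1)))⁻¹ with hKc
  set u : ℝ := (8 : ℝ) ^ (d * k - 1) * ε ^ 2 with hu
  set μV : ℕ → ℝ := fun m => klLipInputMeasDT L M β U μ K d k jw (2 * m) / klLevUnitF β M 0 m (d * k - 1) with hμV
  set μF : ℕ → ℝ := fun m => klLipInputMeasDT (b * L) M β U μ K d k jw (2 * m) / klLevUnitF β M 0 m (d * k - 1) with hμF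
  set dE : ℕ → ℝ := fun m => klLipInputDiffSupDT L b M β U μ K d k (2 * m) Rin / (ε * klLevUnitF β M 0 m (d * k - 1)) with hdE
  set W : ℝ := (32 : ℝ) with hW
  set Z : ℝ := cW ^ 2 / 8 with hZ'
  set σb : ℝ := κb ^ 2 * ε ^ 2 / cW ^ 2 with hσb
  set τb : ℝ := 4 * Real.exp 4 * κb ^ 2 * ε ^ 2 / cW ^ 2 with hτb
  set ψb : ℝ := cW ^ 2 / (κb ^ 2 * ε ^ 2) with hψb
  set Φb : ℝ := Real.exp 1 * αb / κb ^ 2 with hΦb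
  have hKc0 : 0 < Kc := by positivity
  have hu0 : 0 < u := by positivity
  have hW0 : (0 : ℝ) < W := by rw [hW]; norm_num
  have hZ0 : 0 < Z := by positivity
  have ht0 : (0 : ℝ) ≤ 1 / (1 + ΛT * ((r : ℝ) + 1)) := by positivity
  have ht1 : 1 / (1 + ΛT * ((r : ℝ) + 1)) ≤ 1 := by
    rw [div_le_one (by positivity)]
    have : 0 ≤ ΛT * ((r : ℝ) + 1) := by positivity
    linarith
  have hΛinv : 0 ≤ Λ⁻¹ := inv_nonneg.2 (zero_le_one.trans hΛ1)
  have hμV0 : ∀ m, 0 ≤ μV m := fun m =>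
    div_nonneg (klLipInputMeasDT_nonneg hβ.le U μ K d k jw (2 * m)) (klLevUnitF_pos hβ 0 m (d * k - 1)).le
  have hμF0 : ∀ m, 0 ≤ μF m := fun m =>
    div_nonneg (klLipInputMeasDT_nonneg hβ.le U μ K d k jw (2 * m)) (klLevUnitF_pos hβ 0 m (d * k - 1)).le
  have hdE0 : ∀ m, 0 ≤ dE m := fun m =>
    div_nonneg (klLipInputDiffSupDT_nonneg β U μ K d k (2 * m) Rin) (mul_pos hx (klLevUnitF_pos hβ 0 m (d * k - 1))).le
  -- units: `K_c·u^m = ε·klLevUnitF β M 0 m (dk−1)` for `m ≥ 1`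
  have hunit : ∀ m, 1 ≤ m → Kc * u ^ m = ε * klLevUnitF β M 0 m (d * k - 1) := by
    intro m hm
    rw [klLevUnitF_zero_track_eq_units (M := M) hβ hm, hKc, hu, hε]
    have hx1 : imagTimeWeight β M ≠ 0 := hx.ne'
    have hx2 : imagTimeWeight β M ^ 2 ≠ 0 := pow_ne_zero _ hx.ne'
    field_simp
  -- the door's profile hypotheses in these units
  have hNV : ∀ m' (j : Fin (2 * m')) (x : (SrcLabel (b * L) M (d * k - 1))), ∑ Y ∈ univ.filter (fun Y : Fin (2 * m') → (SrcLabel (b * L) M (d * k - 1)) => Y j = x),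
      ‖kernel ℂ (klGlueD L b M (d * k - 1) (klLipInputDT L M β U μ K d k)) (2 * m') Y‖ * klGluedWt L b M β jw (sectorCount (d * k - 1)) ((univ.image Y).image Prod.fst) ≤
        Kc * (u ^ m' * μV m') := by
    intro m' j x
    rcases Nat.eq_zero_or_pos m' with hm' | hm'
    · subst hm'; exact absurd j.isLt (by omega)
    refine (glueD_wt_profile_le_measDT hβ.le U μ K d k jw j x).trans (le_of_eq ?_)
    have hU0 : klLevUnitF β M 0 m' (d * k - 1) ≠ 0 := (klLevUnitF_pos hβ 0 m' (d * k - 1)).ne'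
    rw [← mul_assoc, hunit m' hm']
    simp only [hμV, hε]
    rw [mul_div_assoc', mul_right_comm, mul_div_assoc, div_self hU0, mul_one]
  have hND : ∀ m' (j : Fin (2 * m')) (x : (SrcLabel (b * L) M (d * k - 1))), ∑ Y ∈ univ.filter (fun Y : Fin (2 * m') → (SrcLabel (b * L) M (d * k - 1)) => Y j = x),
      ‖kernel ℂ (klLipInputDiffDT L b M β U μ K d k) (2 * m') Y‖ * klGluedWt L b M β jw (sectorCount (d * k - 1)) ((univ.image Y).image Prod.fst) ≤
        Kc * (u ^ m' * (μF m' + μV m')) := by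
    intro m' j x
    rcases Nat.eq_zero_or_pos m' with hm' | hm'
    · subst hm'; exact absurd j.isLt (by omega)
    refine (inputDiffDT_wt_profile_le_measDT hβ.le U μ K d k jw j x).trans (le_of_eq ?_)
    have hU0 : klLevUnitF β M 0 m' (d * k - 1) ≠ 0 := (klLevUnitF_pos hβ 0 m' (d * k - 1)).ne'
    rw [← mul_assoc, hunit m' hm']
    simp only [hμF, hμV, hε]
    rw [← add_div, mul_div_assoc', mul_right_comm, mul_div_assoc, div_self hU0, mul_one]
  have hE : ∀ m', klLipInputDiffSupDT L b M β U μ K d k (2 * m') Rin ≤ Kc * (u ^ m' * dE m') := by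
    intro m'
    rcases Nat.eq_zero_or_pos m' with hm' | hm'
    · subst hm'
      rw [Nat.mul_zero, klLipInputDiffSupDT_deg_zero]
      exact mul_nonneg hKc0.le (mul_nonneg (pow_nonneg hu0.le _) (hdE0 0))
    refine le_of_eq ?_
    have hU0 : klLevUnitF β M 0 m' (d * k - 1) ≠ 0 := (klLevUnitF_pos hβ 0 m' (d * k - 1)).ne'
    rw [← mul_assoc, hunit m' hm']
    simp only [hdE]
    have hne : ε * klLevUnitF β M 0 m' (d * k - 1) ≠ 0 := mul_ne_zero hx.ne' hU0
    rw [mul_div_assoc', mul_comm (ε * klLevUnitF β M 0 m' (d * k - 1)), mul_div_assoc, div_self hne, mul_one]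
  have hμV00 : μV 0 = 0 := by simp [hμV, klLipInputMeasDT_zero]
  have hμF00 : μF 0 = 0 := by simp [hμF, klLipInputMeasDT_zero]
  have hμD00 : μF 0 + μV 0 = 0 := by rw [hμF00, hμV00, add_zero]
  have hdE00 : dE 0 = 0 := by simp [hdE, klLipInputDiffSupDT_deg_zero]
  -- `8^{dk} = 8^{dk−1}·8`, `4^{dk} = 4^{dk−1}·4`, `2^{5(dk−1)} = 4^{dk−1}·8^{dk−1}`
  have h8succ : (8 : ℝ) ^ (d * k) = (8 : ℝ) ^ (d * k - 1) * 8 := by rw [← pow_succ, Nat.sub_add_cancel hJ₁]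
  have h4succ : (4 : ℝ) ^ (d * k) = (4 : ℝ) ^ (d * k - 1) * 4 := by rw [← pow_succ, Nat.sub_add_cancel hJ₁]
  have h32 : (2 : ℝ) ^ (5 * (d * k - 1)) = (4 : ℝ) ^ (d * k - 1) * (8 : ℝ) ^ (d * k - 1) := by
    rw [← mul_pow, show (4 : ℝ) * 8 = 2 ^ 5 by norm_num, ← pow_mul]
  have h8p : (0 : ℝ) < (8 : ℝ) ^ (d * k - 1) := by positivity
  have h4p : (0 : ℝ) < (4 : ℝ) ^ (d * k - 1) := by positivity
  -- the four parameter identities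
  have hσeq : σb * Z = κ' ^ 2 * u := by
    simp only [hσb, hZ', hu]; rw [← hκ'sq, h8succ]; field_simp
  have hτeq : τb * Z = (Real.exp 2 * (κ' + κ')) ^ 2 * u := by
    simp only [hτb, hZ', hu]; rw [← hκ'sq, h8succ, he4']; field_simp; ring
  have hψeq : ψb / Z = κ'⁻¹ ^ 2 / u := by
    simp only [hψb, hZ', hu]; rw [← hκ'sq, h8succ, inv_pow]; field_simp
  have hΦeq : Φb * W = Real.exp 1 * (αb * (4 : ℝ) ^ (d * k)) / κ' ^ 2 * Kc := by
    simp only [hΦb, hW, hKc]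
    rw [← hκ'sq, h8succ, h4succ, h32]
    field_simp
    ring
  -- the majorant's guard in the door's currency, from the final guard
  have hΦ₁0 : 0 ≤ Real.exp 1 * (αb * (4 : ℝ) ^ (d * k)) / κ' ^ 2 * Kc := by positivity
  have hμbar : (fun m => W * (Z ^ m * (klLipInputMeasDT L M β U μ K d k jw (2 * m) / klLevUnitF β M 0 m (d * k - 1) + (klLipInputMeasDT (b * L) M β U μ K d k jw (2 * m) / klLevUnitF β M 0 m (d * k - 1) + klLipInputMeasDT L M β U μ K d k jw (2 * m) / klLevUnitF β M 0 m (d * k - 1)) + klLipInputDiffSupDT L b M β U μ K d k (2 * m) Rin / (ε * klLevUnitF β M 0 m (d * k - 1))))) = fun m : ℕ => W * (Z ^ m * (μV m + (μF m + μV m) + dE m)) := by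
    funext m; simp only [hdE, hμF, hμV]
  have hg₁ : Real.exp 1 * (αb * (4 : ℝ) ^ (d * k)) / κ' ^ 2 * Kc * towerV D ((Real.exp 2 * (κ' + κ')) ^ 2 * u) (fun m => μV m + (μF m + μV m) + dE m) < 1 := by
    have key : Real.exp 1 * (αb * (4 : ℝ) ^ (d * k)) / κ' ^ 2 * Kc * towerV D ((Real.exp 2 * (κ' + κ')) ^ 2 * u) (fun m => μV m + (μF m + μV m) + dE m) =
        Φb * towerV D τb (fun m => W * (Z ^ m * (klLipInputMeasDT L M β U μ K d k jw (2 * m) / klLevUnitF β M 0 m (d * k - 1) + (klLipInputMeasDT (b * L) M β U μ K d k jw (2 * m) / klLevUnitF β M 0 m (d * k - 1) + klLipInputMeasDT L M β U μ K d k jw (2 * m) / klLevUnitF β M 0 m (d * k - 1)) + klLipInputDiffSupDT L b M β U μ K d k (2 * m) Rin / (ε * klLevUnitF β M 0 m (d * k - 1))))) := by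
      rw [hμbar, towerV_units, hτeq, ← hΦeq]; ring
    rw [key]; exact hguard
  have hle₂ : towerV D ((Real.exp 2 * (κ' + κ')) ^ 2 * u) (fun m => μV m + (μF m + μV m)) ≤
      towerV D ((Real.exp 2 * (κ' + κ')) ^ 2 * u) (fun m => μV m + (μF m + μV m) + dE m) :=
    towerV_mono (by positivity) le_rfl (fun m => add_nonneg (hμV0 m) (add_nonneg (hμF0 m) (hμV0 m))) (fun m => by linarith [hdE0 m])
  have hg₂ : Real.exp 1 * (αb * (4 : ℝ) ^ (d * k)) / κ' ^ 2 * Kc * towerV D ((Real.exp 2 * (κ' + κ')) ^ 2 * u) (fun m => μV m + (μF m + μV m)) < 1 :=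
    lt_of_le_of_lt (mul_le_mul_of_nonneg_left hle₂ hΦ₁0) hg₁
  -- (1) the door's `hstep` in sup form at these units, truncation `Nt + 1`, radius `ρ := κ′`
  have hN₁ : 2 ≤ Nt + 1 := by omega
  have h1 := klLipBornDiffSupDT_le_hstep_rate (L := L) (b := b) (M := M) hβ U μ K hJ₁ hZf hZc hκ'0 hGB' hu0 hKc0 μV (fun m => μF m + μV m) hμV0
    (fun m => add_nonneg (hμF0 m) (hμV0 m)) hNV hND Rin R' dE hdE0 hE hμV00 hμD00 hdE00 hα'0 hrow2 hcol2 hκ'0 hD hg₁ hg₂ hN₁ hΛ1 hΛle jr hΛT hΛr hcW1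
    hrowT hcolT D₀ r hD₀ hRR' hq hN0 hNfar0 hEs0 hNDs0 hN hNfar hEs hNDs
  rw [Nat.add_sub_cancel] at h1
  -- abstract the arrays and the three kit pieces
  set ν₁ : ℕ → ℝ := fun m => dE m + (Λ⁻¹ + 1 / (1 + ΛT * ((r : ℝ) + 1))) * (μF m + μV m) with hν₁
  set μ₁ : ℕ → ℝ := fun m => μV m + (μF m + μV m) + dE m with hμ₁
  have hν₁0 : ∀ m, 0 ≤ ν₁ m := fun m => by
    have h1' := hdE0 m; have h2 := hμF0 m; have h3 := hμV0 m
    simp only [hν₁]; positivity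
  have hμ₁0 : ∀ m, 0 ≤ μ₁ m := fun m => by
    have h1' := hdE0 m; have h2 := hμF0 m; have h3 := hμV0 m
    simp only [hμ₁]; positivity
  set Φ₁ : ℝ := Real.exp 1 * (αb * (4 : ℝ) ^ (d * k)) / κ' ^ 2 * Kc with hΦ₁
  set τ₁ : ℝ := (Real.exp 2 * (κ' + κ')) ^ 2 * u with hτ₁
  set ψ₁ : ℝ := κ'⁻¹ ^ 2 / u with hψ₁
  set σ₁ : ℝ := κ' ^ 2 * u with hσ₁
  set FO : ℝ := towerFO D σ₁ ν₁ p with hFO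
  set GR : ℝ := ∑ n' ∈ Icc 2 Nt, Real.exp 1 * Φ₁ ^ (n' - 1) * ψ₁ ^ p * towerSLip D τ₁ ν₁ μ₁ n' p with hGR
  set TL : ℝ := ψ₁ ^ p * Real.exp 1 * towerV D τ₁ μ₁ * (Φ₁ * towerV D τ₁ μ₁) ^ Nt / (1 - Φ₁ * towerV D τ₁ μ₁) with hTL
  -- (2) the tail coefficient `4 + 2t ≤ 6` (the tail is nonnegative under the guard)
  have htail := kitTail_nonneg (D := D) (N := Nt) (q := p) (τ := τ₁) (Φ := Φ₁) (ψ := ψ₁) (Ct := 1) (μ := μ₁)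
    (by positivity) hΦ₁0 (by positivity) zero_le_one hμ₁0 hg₁
  rw [one_mul] at htail
  have hX : FO + GR + (4 + 2 * (1 / (1 + ΛT * ((r : ℝ) + 1)))) * TL ≤ FO + GR + 6 * TL := by nlinarith [htail, ht1, ht0]
  -- (3) the final kit bracket in these units: `kit(W̄·Z̄^m·ν₁; σ̄, τ̄, Φ̄, ψ̄, 6 | W̄ Z̄^m μ₁) = (Z̄^p·W̄)·(FO + GR + 6·TL)`
  have hkit := kitStepLip_abs_eq_units_mul (K := W) (u := Z) hW0.ne' hZ0.ne' D σb τb Φb ψb 6 ν₁ μ₁ Nt p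
  rw [hσeq, hτeq, hΦeq, hψeq] at hkit
  have hνbar : (fun m => W * (Z ^ m * (klLipInputDiffSupDT L b M β U μ K d k (2 * m) Rin / (ε * klLevUnitF β M 0 m (d * k - 1)) + (Λ⁻¹ + 1 / (1 + ΛT * ((r : ℝ) + 1))) * (klLipInputMeasDT (b * L) M β U μ K d k jw (2 * m) / klLevUnitF β M 0 m (d * k - 1) + klLipInputMeasDT L M β U μ K d k jw (2 * m) / klLevUnitF β M 0 m (d * k - 1))))) = fun m : ℕ => W * (Z ^ m * ν₁ m) := by
    funext m; simp only [hν₁, hdE, hμF, hμV]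
  have hμbar' : (fun m => W * (Z ^ m * (klLipInputMeasDT L M β U μ K d k jw (2 * m) / klLevUnitF β M 0 m (d * k - 1) + (klLipInputMeasDT (b * L) M β U μ K d k jw (2 * m) / klLevUnitF β M 0 m (d * k - 1) + klLipInputMeasDT L M β U μ K d k jw (2 * m) / klLevUnitF β M 0 m (d * k - 1)) + klLipInputDiffSupDT L b M β U μ K d k (2 * m) Rin / (ε * klLevUnitF β M 0 m (d * k - 1))))) = fun m : ℕ => W * (Z ^ m * μ₁ m) := by
    funext m; simp only [hμ₁, hdE, hμF, hμV]
  -- (4) divide by the output unit `ε·klLevUnitF β M 0 p (dk) = (K_c·u^p)·(8^p/32)`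
  have houtU : ε * klLevUnitF β M 0 p (d * k) = (Kc * u ^ p) * ((8 : ℝ) ^ p / 32) := by
    rw [klLevUnitF_zero_track_succ_units (M := M) hβ hJ₁ hp1, hKc, hu, hε]
    have hx1 : imagTimeWeight β M ≠ 0 := hx.ne'
    have hx2 : imagTimeWeight β M ^ 2 ≠ 0 := pow_ne_zero _ hx.ne'
    field_simp
  have hU0 : 0 < ε * klLevUnitF β M 0 p (d * k) := mul_pos hx (klLevUnitF_pos hβ 0 _ _)
  have hout : cW ^ (2 * p - 1) * (u ^ p * Kc) * cW = (Z ^ p * W) * ((Kc * u ^ p) * ((8 : ℝ) ^ p / 32)) := by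
    obtain ⟨p', rfl⟩ : ∃ p', p = p' + 1 := ⟨p - 1, by omega⟩
    simp only [hZ', hW]
    rw [show 2 * (p' + 1) - 1 = 2 * p' + 1 by omega, div_pow]
    field_simp
    ring
  rw [hνbar, hμbar', hkit, div_le_iff₀ hU0, houtU]
  have hA0 : 0 ≤ cW ^ (2 * p - 1) * (u ^ p * Kc) * cW := by positivity
  calc klLipBornDiffSupDT L b M β U μ K d k (n + 1) (D₀ + r)
      ≤ cW ^ (2 * p - 1) * (u ^ p * Kc) * (cW * (FO + GR + (4 + 2 * (1 / (1 + ΛT * ((r : ℝ) + 1)))) * TL)) + (cW ^ n * (cW * Es + cW / (1 + ΛT * ((r : ℝ) + 1)) * NDs) + (2 * cW ^ n * (cW / (1 + ΛT * ((r : ℝ) + 1))) * N + n * cW ^ n * (5 * (cW / (1 + ΛT * ((r : ℝ) + 1))) * N + 2 * cW * Nfar))) := h1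
    _ = (cW ^ (2 * p - 1) * (u ^ p * Kc) * cW) * (FO + GR + (4 + 2 * (1 / (1 + ΛT * ((r : ℝ) + 1)))) * TL) + (cW ^ n * (cW * Es + cW / (1 + ΛT * ((r : ℝ) + 1)) * NDs) + (2 * cW ^ n * (cW / (1 + ΛT * ((r : ℝ) + 1))) * N + n * cW ^ n * (5 * (cW / (1 + ΛT * ((r : ℝ) + 1))) * N + 2 * cW * Nfar))) := by ring
    _ ≤ (cW ^ (2 * p - 1) * (u ^ p * Kc) * cW) * (FO + GR + 6 * TL) + (cW ^ n * (cW * Es + cW / (1 + ΛT * ((r : ℝ) + 1)) * NDs) + (2 * cW ^ n * (cW / (1 + ΛT * ((r : ℝ) + 1))) * N + n * cW ^ n * (5 * (cW / (1 + ΛT * ((r : ℝ) + 1))) * N + 2 * cW * Nfar))) :=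
        add_le_add (mul_le_mul_of_nonneg_left hX hA0) le_rfl
    _ = (Z ^ p * W * (FO + GR + 6 * TL) + (cW ^ n * (cW * Es + cW / (1 + ΛT * ((r : ℝ) + 1)) * NDs) + (2 * cW ^ n * (cW / (1 + ΛT * ((r : ℝ) + 1))) * N + n * cW ^ n * (5 * (cW / (1 + ΛT * ((r : ℝ) + 1))) * N + 2 * cW * Nfar))) / ((Kc * u ^ p) * ((8 : ℝ) ^ p / 32))) * ((Kc * u ^ p) * ((8 : ℝ) ^ p / 32)) := by
        rw [hout, add_mul, div_mul_cancel₀ _ (by rw [← houtU]; exact hU0.ne')]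
        ring

end Summit.HubbardSuperconductivity.HubbardSuperconductivity.Theorems.TwoVolumeLip

end
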